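import Literature.NumberTheory.Automorphic.UnitaryLatticeTreeEulerRelation   -- ★ root star = `K₀·N₁`, `latticeGraphIso_apply_eq_self_iff`, `eq_of_forall_mem_iff`, `exists_mem_neighborSet_root_forall_mem_iff`
import Literature.NumberTheory.Automorphic.UnitaryLatticeTreeRootStarCount   -- ★ V2b (brings ★ FixedStar `latticeGraphIso_N₁_eq_iff`, `exists_unit_congr_of_forall_v_B₀_lt_one`; residues; ★ `natCard_traceKer`)
import HarnessLib

/-!
# R90 · S6 «Ch. 14.1–14.5 stable trace formula» — card W8-i″, FILE 3c-A (RESIDUAL VALUE «PLANE-SCALAR ⊕ SEPARATED LINE» ↦ `q + 1`) (`Theorems/R90S6ResidualStarFixedPlaneScalar.lean`)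

Cell `hodgecm-mathlib`, crux H413 (`stmt-HodgeConjecture-24833`), route of record `HCCMUnconditional`; programme R90-TF, section S6 (base `R90-C14`), seat R90-C14-p05 (g0);
S6 dealer R90-C14-plan (g2) 00:39:05Z ∕ 00:52:55Z «type 3c-A in FRAME form now … ↦ q + 1 with the `hq` binder, frame letters as 3c-B» (DAG r5 row E1.3.5.2.4; regime R-II
of the S1 taxonomy).  Helper lane `--supports stmt-HodgeConjecture-24833 --as helper`; ONE theorem (no definition, no instance, no notation, no named fact, no `sorry`).

THE MATHEMATICS [Tits1979, §3.5; BruhatTits1972, §10; Serre1980Trees, II.1.1; Wilson2009, §3.6.1].  The star of `L₀ = 𝒪³` is `{N_x}` over the isotropic points `[x̄]` of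
`(𝓀³, B̄₀)` (★ V2a∕V2b) and `k ∈ K₀` fixes `N_x` iff `k̄x̄ ∈ 𝓀^× x̄` (★ `latticeGraphIso_N₁_eq_iff`).  FRAME HYPOTHESES: `P, P⁻¹` integral (columns `p₀, p₁, p₂`),
`A = P⁻¹kP ≡ diag(c₁, c₁, A₂₂)` entrywise mod `𝔪` with `|A₂₂ − c₁| = 1`, `|B₀(p₂,p₂)| = 1`, and the plane frame residually HYPERBOLIC (`B₀(p₀,p₀), B₀(p₁,p₁) ∈ 𝔪`,
`|B₀(p₀,p₁)| = 1`).  CLAIM: the `k`-fixed vertices of the star are `N_{p₁}` and the `N_{p₀ + b p₁}` for the `q` residues `b̄` with `b̄ḡ + σ(b̄ḡ) = 0` (`g = B₀(p₀,p₁)`;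
`|𝓀| = q²`, `σk` the `q`-Frobenius, ★ `natCard_traceKer`) — total `q + 1`.  PROOF: (fixed ⇒) `Ay ≡ c′y` for `y = P⁻¹x`; `|y₂| = 1` would give `c′ ≡ A₂₂ ≢ c₁`, `y₀, y₁ ∈ 𝔪`,
`x ≡ y₂p₂`, `|B₀(x,x)| = 1` — impossible; so `x ≡ y₀p₀ + y₁p₁`, normalised to `p₀ + bp₁` (`|y₀| = 1`; isotropy gives the trace condition) or `p₁`; (⇐) `kx ≡ c₁x` on such `x`;
distinct normal forms give distinct hyperplanes (★ `exists_unit_congr_of_forall_v_B₀_lt_one` read through `P⁻¹`).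
HONEST LABEL: lattice bookkeeping over ★ organs; the value «`c₁`-plane ⊕ separated line ↦ q + 1» of the residual census `s(x)` of ★ FILE 1 ∘ ★ FILE 2 (regime R-II); count-neutral
until rung 1′ and W8-f consume it; proves no printed statement.  HC_CM is proved only modulo the 7 printed citations (2 remaining named inputs: hLiu418 = stmt-HodgeConjecture-24832,
h413 = stmt-HodgeConjecture-24833) until rung 0 closes.
-/

set_option autoImplicit false
-- the mandated namespace repeats the single-problem summit's segment (`HodgeConjecture.HodgeConjecture`)
set_option linter.dupNamespace false

noncomputable section

open Literature.NumberTheory.Automorphic Literature.NumberTheory.Automorphic.HermitianLattice Literature.NumberTheory.Automorphic.UnitaryGroup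
open Literature.NumberTheory.Automorphic.UnitaryLatticeTree Literature.NumberTheory.Automorphic.CartanUnique Literature.FieldTheory.FiniteFields
open scoped Matrix MatrixGroups WithZero Valued

namespace Summit.HodgeConjecture.HodgeConjecture.R90.S6

/-- **W8-i″ FILE 3c-A — «RESIDUALLY `c₁`·SCALAR ON A NON-DEGENERATE PLANE ⊕ A SEPARATED LINE» FIXES EXACTLY `q + 1` VERTICES OF THE STAR OF THE ROOT.**  For an unramified
datum `hd` (`σ(𝒪) ⊆ 𝒪` reducing to `σk`, `|𝓀| = q²`, `σk = Frob_q`), `k ∈ K₀`, a frame `P ∈ GL₃(K)` with `P`, `P⁻¹` integral such that `A = P⁻¹kP` has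
`|A₀₀ − c₁|, |A₁₁ − c₁| < 1`, `|A₂₂ − c₁| = 1` and ALL off-diagonal entries in `𝔪` (`|c₁| = 1`), with `|B₀(Pe₂,Pe₂)| = 1` and the plane frame residually hyperbolic
(`|B₀(Pe₀,Pe₀)|, |B₀(Pe₁,Pe₁)| < 1`, `|B₀(Pe₀,Pe₁)| = 1`): the `k`-fixed vertices of the star of `L₀ = 𝒪³` in ★ `latticeGraph σ ϖ J₀` are the `q + 1` hyperplanes `N_x`,
`x̄` an isotropic point of the residual plane `⟨p̄₀, p̄₁⟩`, so the count of ★ FILE 2 is `q + 1`. [cite: Tits1979, §3.5] [cite: BruhatTits1972, §10] [cite: Wilson2009, §3.6.1] -/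
theorem ncard_fixed_neighborSet_root_eq_residualIso_of_residually_plane_scalar {K : Type*} [Field K] [Valued K ℤᵐ⁰]
    {σ : K →+* K} {ϖ : K} (hd : UnramifiedLocalConjDatum σ ϖ) (hσO : ∀ x : 𝒪[K], σ x ∈ 𝒪[K]) (σk : 𝓀[K] →+* 𝓀[K])
    (hσk : ∀ x : 𝒪[K], IsLocalRing.residue 𝒪[K] ⟨σ x, hσO x⟩ = σk (IsLocalRing.residue 𝒪[K] x))
    [Fintype 𝓀[K]] {q : ℕ} (hq : Fintype.card 𝓀[K] = q ^ 2) (hfrob : ∀ y, σk y = y ^ q)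
    (k : ↥(unitaryGroupOfForm σ ((StdForm.antidiagonal 3).over K))) (hk : k ∈ unitaryInt σ ((StdForm.antidiagonal 3).over K))
    (P : GL (Fin 3) K) (hP : ∀ i j, Valued.v ((P : Matrix (Fin 3) (Fin 3) K) i j) ≤ 1) (hP' : ∀ i j, Valued.v (((P⁻¹ : GL (Fin 3) K) : Matrix (Fin 3) (Fin 3) K) i j) ≤ 1)
    {c₁ : K} (hc₁ : Valued.v c₁ = 1)
    (h00 : Valued.v ((((P⁻¹ : GL (Fin 3) K) : Matrix (Fin 3) (Fin 3) K) * ((k : GL (Fin 3) K) : Matrix (Fin 3) (Fin 3) K) * (P : Matrix (Fin 3) (Fin 3) K)) 0 0 - c₁) < 1)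
    (h11 : Valued.v ((((P⁻¹ : GL (Fin 3) K) : Matrix (Fin 3) (Fin 3) K) * ((k : GL (Fin 3) K) : Matrix (Fin 3) (Fin 3) K) * (P : Matrix (Fin 3) (Fin 3) K)) 1 1 - c₁) < 1)
    (h22 : Valued.v ((((P⁻¹ : GL (Fin 3) K) : Matrix (Fin 3) (Fin 3) K) * ((k : GL (Fin 3) K) : Matrix (Fin 3) (Fin 3) K) * (P : Matrix (Fin 3) (Fin 3) K)) 2 2 - c₁) = 1)
    (hoff : ∀ i j : Fin 3, i ≠ j →
      Valued.v ((((P⁻¹ : GL (Fin 3) K) : Matrix (Fin 3) (Fin 3) K) * ((k : GL (Fin 3) K) : Matrix (Fin 3) (Fin 3) K) * (P : Matrix (Fin 3) (Fin 3) K)) i j) < 1)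
    (hp00 : Valued.v (B₀ σ 3 ((P : Matrix (Fin 3) (Fin 3) K).mulVec (Pi.single 0 1)) ((P : Matrix (Fin 3) (Fin 3) K).mulVec (Pi.single 0 1))) < 1)
    (hp11 : Valued.v (B₀ σ 3 ((P : Matrix (Fin 3) (Fin 3) K).mulVec (Pi.single 1 1)) ((P : Matrix (Fin 3) (Fin 3) K).mulVec (Pi.single 1 1))) < 1)
    (hp01 : Valued.v (B₀ σ 3 ((P : Matrix (Fin 3) (Fin 3) K).mulVec (Pi.single 0 1)) ((P : Matrix (Fin 3) (Fin 3) K).mulVec (Pi.single 1 1))) = 1)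
    (hp2 : Valued.v (B₀ σ 3 ((P : Matrix (Fin 3) (Fin 3) K).mulVec (Pi.single 2 1)) ((P : Matrix (Fin 3) (Fin 3) K).mulVec (Pi.single 2 1))) = 1) :
    {w : {M : Submodule 𝒪[K] (Fin 3 → K) // IsVertex σ ϖ ((StdForm.antidiagonal 3).over K) M} |
        w ∈ (latticeGraph σ ϖ ((StdForm.antidiagonal 3).over K)).neighborSet ⟨stdLattice K 3, 0, isSelfDualLattice_stdLattice_three hd⟩ ∧
          latticeGraphIso σ ϖ ((StdForm.antidiagonal 3).over K) k w = w}.ncard = q + 1 := by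
  classical
  have hϖ0 : ϖ ≠ 0 := uniformizer_ne_zero hd.vϖ
  have hϖ1 : Valued.v ϖ ≤ 1 := uniformizer_mem_integer hd.vϖ
  have hlt1 : ∀ z : K, Valued.v z < 1 ↔ Valued.v z ≤ Valued.v ϖ := fun z => by rw [hd.vϖ]; exact v_lt_one_iff z
  have herm : ∀ y z : Fin 3 → K, B₀ σ 3 z y = σ (B₀ σ 3 y z) := fun y z => (isHermitianForm_B₀ hd.σσ y z).symm
  set kM : Matrix (Fin 3) (Fin 3) K := ((k : GL (Fin 3) K) : Matrix (Fin 3) (Fin 3) K) with hkM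
  set PM : Matrix (Fin 3) (Fin 3) K := (P : Matrix (Fin 3) (Fin 3) K) with hPM
  set QM : Matrix (Fin 3) (Fin 3) K := ((P⁻¹ : GL (Fin 3) K) : Matrix (Fin 3) (Fin 3) K) with hQM
  set A : Matrix (Fin 3) (Fin 3) K := QM * kM * PM with hA
  have hPQ : PM * QM = 1 := by rw [hPM, hQM, ← Units.val_mul, mul_inv_cancel, Units.val_one]
  have hQP : QM * PM = 1 := by rw [hPM, hQM, ← Units.val_mul, inv_mul_cancel, Units.val_one]
  -- GENERIC ESTIMATES: `|a| ≤ 1`, `|b| < 1 ⇒ |ab| < 1`; integral matrices map `𝔪³` to `𝔪³`; `B₀` of a small vector against an integral one is small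
  have hm1 : ∀ a b : ℤᵐ⁰, a ≤ 1 → b < 1 → a * b < 1 := fun a b ha hb => by rw [mul_comm]; exact mul_lt_one_of_lt_of_le hb ha
  have hMv : ∀ (M : Matrix (Fin 3) (Fin 3) K), (∀ i j, Valued.v (M i j) ≤ 1) → ∀ z : Fin 3 → K, (∀ a, Valued.v (z a) < 1) → ∀ i, Valued.v ((M.mulVec z) i) < 1 := by
    intro M hM z hz i
    change Valued.v (∑ a, M i a * z a) < 1
    refine Valuation.map_sum_lt _ one_ne_zero fun a _ => ?_
    rw [map_mul]; exact hm1 _ _ (hM i a) (hz a)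
  have hBl : ∀ r y : Fin 3 → K, (∀ i, Valued.v (r i) < 1) → y ∈ stdLattice K 3 → Valued.v (B₀ σ 3 r y) < 1 := by
    intro r y hr hy
    rw [B₀_apply]
    refine Valuation.map_sum_lt _ one_ne_zero fun a _ => ?_
    rw [map_mul, hd.vσ]; exact mul_lt_one_of_lt_of_le (hr a) (hy _)
  have hBr : ∀ y r : Fin 3 → K, y ∈ stdLattice K 3 → (∀ i, Valued.v (r i) < 1) → Valued.v (B₀ σ 3 y r) < 1 := by
    intro y r hy hr
    rw [herm, hd.vσ]; exact hBl r y hr hy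
  -- THE FRAME COLUMNS `p₀, p₁, p₂` (opaque), `P z = z₀p₀ + z₁p₁ + z₂p₂`, `P⁻¹ pⱼ = eⱼ`
  obtain ⟨p₀, hp₀⟩ : ∃ p : Fin 3 → K, p = PM.mulVec (Pi.single 0 1) := ⟨_, rfl⟩
  obtain ⟨p₁, hp₁⟩ : ∃ p : Fin 3 → K, p = PM.mulVec (Pi.single 1 1) := ⟨_, rfl⟩
  obtain ⟨p₂, hp₂⟩ : ∃ p : Fin 3 → K, p = PM.mulVec (Pi.single 2 1) := ⟨_, rfl⟩
  rw [← hp₀] at hp00 hp01; rw [← hp₁] at hp11 hp01; rw [← hp₂] at hp2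
  have hp₀int : p₀ ∈ stdLattice K 3 := by rw [hp₀]; exact mulVec_mem_stdLattice_of_forall_v_le_one hP (single_mem_stdLattice 0)
  have hp₁int : p₁ ∈ stdLattice K 3 := by rw [hp₁]; exact mulVec_mem_stdLattice_of_forall_v_le_one hP (single_mem_stdLattice 1)
  have hp₂int : p₂ ∈ stdLattice K 3 := by rw [hp₂]; exact mulVec_mem_stdLattice_of_forall_v_le_one hP (single_mem_stdLattice 2)
  have hPdec : ∀ z : Fin 3 → K, PM.mulVec z = z 0 • p₀ + z 1 • p₁ + z 2 • p₂ := by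
    intro z
    have e : z = z 0 • (Pi.single 0 1 : Fin 3 → K) + z 1 • (Pi.single 1 1 : Fin 3 → K) + z 2 • (Pi.single 2 1 : Fin 3 → K) := by
      funext a; fin_cases a <;> simp
    conv_lhs => rw [e]
    rw [Matrix.mulVec_add, Matrix.mulVec_add, Matrix.mulVec_smul, Matrix.mulVec_smul, Matrix.mulVec_smul, ← hp₀, ← hp₁, ← hp₂]
  have hQp₀ : QM.mulVec p₀ = Pi.single 0 1 := by rw [hp₀, Matrix.mulVec_mulVec, hQP, Matrix.one_mulVec]
  have hQp₁ : QM.mulVec p₁ = Pi.single 1 1 := by rw [hp₁, Matrix.mulVec_mulVec, hQP, Matrix.one_mulVec]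
  have hprim : ∀ x : Fin 3 → K, x ∈ stdLattice K 3 → (∃ j, Valued.v ((QM.mulVec x) j) = 1) → ∃ j, Valued.v (x j) = 1 := by
    intro x hx ⟨j, hj⟩
    by_contra hne
    push Not at hne
    exact absurd hj (hMv QM hP' x (fun a => lt_of_le_of_ne (hx a) (hne a)) j).ne
  -- `k pⱼ ≡ c₁ pⱼ (mod 𝔪)` for `j = 0, 1` (columns `0, 1` of `A − c₁·1` are in `𝔪`)
  have hAc : ∀ a j : Fin 3, j ≠ 2 → Valued.v (A a j - c₁ * (Pi.single j 1 : Fin 3 → K) a) < 1 := by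
    intro a j hj
    by_cases ha : a = j
    · subst ha
      rw [Pi.single_eq_same, mul_one]
      fin_cases a
      exacts [h00, h11, absurd rfl hj]
    · rw [Pi.single_eq_of_ne ha, mul_zero, sub_zero]; exact hoff a j ha
  have hkcol : ∀ j : Fin 3, j ≠ 2 → ∀ i, Valued.v ((kM.mulVec (PM.mulVec (Pi.single j 1)) - c₁ • PM.mulVec (Pi.single j 1)) i) < 1 := by
    intro j hj
    have e : kM.mulVec (PM.mulVec (Pi.single j 1)) - c₁ • PM.mulVec (Pi.single j 1) = PM.mulVec (A.mulVec (Pi.single j 1) - c₁ • Pi.single j 1) := by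
      rw [Matrix.mulVec_sub, Matrix.mulVec_smul, Matrix.mulVec_mulVec, Matrix.mulVec_mulVec, hA, ← Matrix.mul_assoc, ← Matrix.mul_assoc, hPQ, Matrix.one_mul]
    rw [e]
    refine hMv PM hP _ fun a => ?_
    rw [Pi.sub_apply, Pi.smul_apply, smul_eq_mul, Matrix.mulVec_single_one]
    exact hAc a j hj
  have hkp₀ : ∀ i, Valued.v ((kM.mulVec p₀ - c₁ • p₀) i) < 1 := by rw [hp₀]; exact hkcol 0 (by decide)
  have hkp₁ : ∀ i, Valued.v ((kM.mulVec p₁ - c₁ • p₁) i) < 1 := by rw [hp₁]; exact hkcol 1 (by decide)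
  -- RESIDUES: a section of the residue map, the unit `g = B₀(p₀,p₁)` and its residue `ḡ ≠ 0`
  obtain ⟨lift, hlift⟩ : ∃ lift : 𝓀[K] → 𝒪[K], ∀ a, IsLocalRing.residue 𝒪[K] (lift a) = a :=
    ⟨Function.surjInv IsLocalRing.residue_surjective, Function.surjInv_eq IsLocalRing.residue_surjective⟩
  set g : 𝒪[K] := ⟨B₀ σ 3 p₀ p₁, hp01.le⟩ with hg
  have hgbar : IsLocalRing.residue 𝒪[K] g ≠ 0 := fun h => by
    rw [residue_eq_zero_iff_v_lt_one] at h; exact absurd hp01 h.ne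
  -- `E b = b g + σ(b g) ∈ 𝒪` reduces to `b̄ḡ + σk(b̄ḡ)`, and `B₀(p₀ + b p₁, p₀ + b p₁) = E b + (B₀(p₀,p₀) + σb·b·B₀(p₁,p₁))`
  have hE : ∀ b : 𝒪[K], IsLocalRing.residue 𝒪[K] (b * g + ⟨σ ((b * g : 𝒪[K]) : K), hσO (b * g)⟩) =
      IsLocalRing.residue 𝒪[K] b * IsLocalRing.residue 𝒪[K] g + σk (IsLocalRing.residue 𝒪[K] b * IsLocalRing.residue 𝒪[K] g) := fun b => by
    rw [map_add, hσk, map_mul]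
  have hBu : ∀ b : 𝒪[K], B₀ σ 3 (p₀ + (b : K) • p₁) (p₀ + (b : K) • p₁) =
      ((b * g + ⟨σ ((b * g : 𝒪[K]) : K), hσO (b * g)⟩ : 𝒪[K]) : K) + (B₀ σ 3 p₀ p₀ + σ (b : K) * (b : K) * B₀ σ 3 p₁ p₁) := by
    intro b
    simp only [map_add, LinearMap.add_apply, B₀_smul_left, map_smul, smul_eq_mul]
    rw [herm p₀ p₁]; push_cast; rw [map_mul]; ring
  have hBu_tail : ∀ b : 𝒪[K], Valued.v (B₀ σ 3 p₀ p₀ + σ (b : K) * (b : K) * B₀ σ 3 p₁ p₁) < 1 := fun b => by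
    refine Valuation.map_add_lt _ hp00 ?_
    rw [map_mul, map_mul, hd.vσ]; exact hm1 _ _ (mul_le_one' b.2 b.2) hp11
  -- THE PARAMETERS `t` (`σk t + t = 0`) and the normal forms `x_∞ = p₁`, `x_t = p₀ + b_t p₁` (`b̄_t = t ḡ⁻¹`)
  obtain ⟨bOf, hbOf⟩ : ∃ bOf : {t : 𝓀[K] // σk t + t = 0} → 𝒪[K], ∀ t, bOf t = lift (t.1 * (IsLocalRing.residue 𝒪[K] g)⁻¹) := ⟨_, fun _ => rfl⟩
  have hbres : ∀ t, IsLocalRing.residue 𝒪[K] (bOf t) * IsLocalRing.residue 𝒪[K] g = t.1 := fun t => by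
    rw [hbOf, hlift, inv_mul_cancel_right₀ hgbar]
  obtain ⟨xOf, hxnone, hxsome⟩ : ∃ xOf : Option {t : 𝓀[K] // σk t + t = 0} → (Fin 3 → K), xOf none = p₁ ∧ ∀ t, xOf (some t) = p₀ + (bOf t : K) • p₁ :=
    ⟨fun p => p.elim p₁ fun t => p₀ + (bOf t : K) • p₁, rfl, fun _ => rfl⟩
  have hQx : ∀ t, QM.mulVec (xOf (some t)) = Pi.single 0 1 + (bOf t : K) • Pi.single 1 1 := fun t => by
    rw [hxsome, Matrix.mulVec_add, Matrix.mulVec_smul, hQp₀, hQp₁]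
  have hul : ∀ b : 𝒪[K], p₀ + (b : K) • p₁ ∈ stdLattice K 3 := fun b i => by
    rw [Pi.add_apply, Pi.smul_apply, smul_eq_mul]
    refine Valuation.map_add_le _ (hp₀int i) ?_
    rw [map_mul]; exact mul_le_one' b.2 (hp₁int i)
  have hcomb : ∀ (a b : K) (u u' : Fin 3 → K), Valued.v a < 1 → Valued.v b < 1 → u ∈ stdLattice K 3 → u' ∈ stdLattice K 3 →
      ∀ i, Valued.v ((a • u + b • u') i) < 1 := by
    intro a b u u' ha hb hu hu' i
    rw [Pi.add_apply, Pi.smul_apply, Pi.smul_apply, smul_eq_mul, smul_eq_mul]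
    refine Valuation.map_add_lt _ ?_ ?_
    · rw [map_mul]; exact mul_lt_one_of_lt_of_le ha (hu i)
    · rw [map_mul]; exact mul_lt_one_of_lt_of_le hb (hu' i)
  have hxL : ∀ p, xOf p ∈ stdLattice K 3 := by
    rintro (_ | t)
    · rw [hxnone]; exact hp₁int
    · rw [hxsome]; exact hul _
  have hxu : ∀ p, ∃ j, Valued.v (xOf p j) = 1 := by
    rintro (_ | t)
    · exact hprim _ (hxL none) ⟨1, by rw [hxnone, hQp₁, Pi.single_eq_same, map_one]⟩
    · exact hprim _ (hxL (some t)) ⟨0, by rw [hQx, Pi.add_apply, Pi.smul_apply, Pi.single_eq_same, Pi.single_eq_of_ne (by decide), smul_zero, add_zero, map_one]⟩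
  have hxiso : ∀ p, Valued.v (B₀ σ 3 (xOf p) (xOf p)) < 1 := by
    rintro (_ | t)
    · rw [hxnone]; exact hp11
    · rw [hxsome, hBu]
      refine Valuation.map_add_lt _ ?_ (hBu_tail _)
      rw [← residue_eq_zero_iff_v_lt_one, hE, hbres, add_comm]; exact t.2
  have hkx : ∀ p, ∀ i, Valued.v ((kM.mulVec (xOf p) - c₁ • xOf p) i) < 1 := by
    rintro (_ | t) i
    · rw [hxnone]; exact hkp₁ i
    · have e : (kM.mulVec (xOf (some t)) - c₁ • xOf (some t)) i = (kM.mulVec p₀ - c₁ • p₀) i + (bOf t : K) * (kM.mulVec p₁ - c₁ • p₁) i := by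
        rw [hxsome, Matrix.mulVec_add, Matrix.mulVec_smul]
        simp only [Pi.add_apply, Pi.sub_apply, Pi.smul_apply, smul_eq_mul]
        ring
      rw [e]
      refine Valuation.map_add_lt _ (hkp₀ i) ?_
      rw [map_mul]; exact hm1 _ _ (bOf t).2 (hkp₁ i)
  -- THE VERTICES `N_{x_p}`; each is `k`-fixed (`k x_p ≡ c₁ x_p`)
  choose f hf using fun p => exists_mem_neighborSet_root_forall_mem_iff hd (hxL p) (hxu p) (hxiso p)
  have hffix : ∀ p, latticeGraphIso σ ϖ ((StdForm.antidiagonal 3).over K) k (f p) = f p := by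
    intro p
    have hBk : ∀ y : Fin 3 → K, y ∈ stdLattice K 3 → Valued.v (B₀ σ 3 (kM.mulVec (xOf p)) y - σ c₁ * B₀ σ 3 (xOf p) y) < 1 := by
      intro y hy
      have e : B₀ σ 3 (kM.mulVec (xOf p)) y - σ c₁ * B₀ σ 3 (xOf p) y = B₀ σ 3 (kM.mulVec (xOf p) - c₁ • xOf p) y := by
        rw [map_sub, LinearMap.sub_apply, B₀_smul_left]
      rw [e]; exact hBl _ y (hkx p) hy
    rw [latticeGraphIso_apply_eq_self_iff]
    refine SetLike.ext fun y => ?_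
    rw [mem_mapGL_iff, (hf p).2, (hf p).2, ← Subgroup.coe_inv, ← B₀_mulVec_eq_B₀_inv_mulVec]
    have hkz : kM.mulVec ((((k⁻¹ : ↥(unitaryGroupOfForm σ ((StdForm.antidiagonal 3).over K))) : GL (Fin 3) K) : Matrix (Fin 3) (Fin 3) K).mulVec y) = y := by
      rw [Matrix.mulVec_mulVec, hkM, Subgroup.coe_inv, ← Units.val_mul, mul_inv_cancel, Units.val_one, Matrix.one_mulVec]
    constructor
    · rintro ⟨hz, hB⟩
      have hy : y ∈ stdLattice K 3 := by rw [← hkz]; exact mulVec_mem_stdLattice_of_mem_unitaryInt hk hz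
      refine ⟨hy, ?_⟩
      have e : σ c₁ * B₀ σ 3 (xOf p) y = B₀ σ 3 (kM.mulVec (xOf p)) y - (B₀ σ 3 (kM.mulVec (xOf p)) y - σ c₁ * B₀ σ 3 (xOf p) y) := by ring
      have h' : Valued.v (σ c₁ * B₀ σ 3 (xOf p) y) < 1 := by rw [e]; exact Valuation.map_sub_lt _ hB (hBk y hy)
      rwa [map_mul, hd.vσ, hc₁, one_mul] at h'
    · rintro ⟨hy, hB⟩
      refine ⟨mulVec_mem_stdLattice_of_mem_unitaryInt_inv hk hy, ?_⟩
      have e : B₀ σ 3 (kM.mulVec (xOf p)) y = (B₀ σ 3 (kM.mulVec (xOf p)) y - σ c₁ * B₀ σ 3 (xOf p) y) + σ c₁ * B₀ σ 3 (xOf p) y := by ring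
      rw [e]
      refine Valuation.map_add_lt _ (hBk y hy) ?_
      rw [map_mul, hd.vσ, hc₁, one_mul]; exact hB
  -- THE MAP `p ↦ N_{x_p}` INTO THE FIXED STAR IS A BIJECTION
  have hbij : Function.Bijective fun p => (⟨f p, (hf p).1, hffix p⟩ :
      {w : {M : Submodule 𝒪[K] (Fin 3 → K) // IsVertex σ ϖ ((StdForm.antidiagonal 3).over K) M} |
        w ∈ (latticeGraph σ ϖ ((StdForm.antidiagonal 3).over K)).neighborSet ⟨stdLattice K 3, 0, isSelfDualLattice_stdLattice_three hd⟩ ∧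
          latticeGraphIso σ ϖ ((StdForm.antidiagonal 3).over K) k w = w}) := by
    constructor
    · intro p p' hpp'  -- injective: equal hyperplanes ⇒ residually proportional normal forms (★) ⇒ equal parameters, read through `P⁻¹`
      have hEq : f p = f p' := congrArg Subtype.val hpp'
      have hsub : ∀ y ∈ stdLattice K 3, Valued.v (B₀ σ 3 (xOf p) y) < 1 → Valued.v (B₀ σ 3 (xOf p') y) < 1 := fun y hy h => by
        have h1 := ((hf p).2 y).2 ⟨hy, h⟩
        rw [hEq] at h1
        exact (((hf p').2 y).1 h1).2
      obtain ⟨c, hc, hcong⟩ := exists_unit_congr_of_forall_v_B₀_lt_one hd.vσ (hxL p) (hxu p) (hxL p') (hxu p') hsub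
      have hQc : ∀ i, Valued.v ((QM.mulVec (xOf p')) i - c * (QM.mulVec (xOf p)) i) < 1 := by
        intro i
        have e : (QM.mulVec (xOf p')) i - c * (QM.mulVec (xOf p)) i = (QM.mulVec (xOf p' - c • xOf p)) i := by
          rw [Matrix.mulVec_sub, Matrix.mulVec_smul, Pi.sub_apply, Pi.smul_apply, smul_eq_mul]
        rw [e]
        exact hMv QM hP' _ (fun a => by rw [Pi.sub_apply, Pi.smul_apply, smul_eq_mul]; exact hcong a) i
      have hz0 : ∀ t, (QM.mulVec (xOf (some t))) 0 = 1 := fun t => by rw [hQx]; simp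
      have hz1 : ∀ t, (QM.mulVec (xOf (some t))) 1 = (bOf t : K) := fun t => by rw [hQx]; simp
      have hn0 : (QM.mulVec (xOf none)) 0 = 0 := by rw [hxnone, hQp₁]; simp
      rcases p with _ | t <;> rcases p' with _ | t'
      · rfl
      · have h := hQc 0; rw [hz0, hn0, mul_zero, sub_zero, map_one] at h; exact absurd h (lt_irrefl _)
      · have h := hQc 0; rw [hz0, hn0, mul_one, zero_sub, Valuation.map_neg, hc] at h; exact absurd h (lt_irrefl _)
      · have h0 := hQc 0; rw [hz0, hz0, mul_one] at h0
        have h1 := hQc 1; rw [hz1, hz1] at h1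
        have hbb : Valued.v (((bOf t' : 𝒪[K]) : K) - (bOf t : K)) < 1 := by
          have e : ((bOf t' : 𝒪[K]) : K) - (bOf t : K) = ((bOf t' : K) - c * (bOf t : K)) - (1 - c) * (bOf t : K) := by ring
          rw [e]
          refine Valuation.map_sub_lt _ h1 ?_
          rw [map_mul]; exact mul_lt_one_of_lt_of_le h0 (bOf t).2
        rw [Subtype.ext (show t'.1 = t.1 by rw [← hbres t', ← hbres t, residue_eq_of_v_sub_lt_one hbb])]
    · rintro ⟨w, hw, hfix⟩  -- surjective: a fixed vertex `w = N_x` of the star is the hyperplane of a normal form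
      obtain ⟨κ, hκ, hw1⟩ := (mem_neighborSet_root_iff_exists_mem_unitaryInt hd w).1 hw
      obtain ⟨c', hc', hcol⟩ := (latticeGraphIso_N₁_eq_iff hd.vσ hd.vϖ hk hκ w hw1).1 hfix
      set κM : Matrix (Fin 3) (Fin 3) K := ((κ : GL (Fin 3) K) : Matrix (Fin 3) (Fin 3) K) with hκM
      obtain ⟨x, hx⟩ : ∃ x : Fin 3 → K, x = κM.mulVec (Pi.single 0 1) := ⟨_, rfl⟩
      obtain ⟨hxint, hxiso0, i₀, hxi₀⟩ := firstColumn_props hκ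
      rw [← hκM, ← hx] at hxint hxiso0 hxi₀
      have hxcol : ∀ i, x i = κM i 0 := fun i => by rw [hx, Matrix.mulVec_single_one]; rfl
      have hcol' : ∀ i, Valued.v ((kM.mulVec x - c' • x) i) < 1 := by
        intro i
        have e : (kM.mulVec x - c' • x) i = (kM * κM) i 0 - c' * κM i 0 := by
          rw [Pi.sub_apply, Pi.smul_apply, smul_eq_mul, hxcol, Matrix.mul_apply]
          simp only [Matrix.mulVec, dotProduct, hxcol]
        rw [e]
        exact hcol i
      have hmem : ∀ y', y' ∈ w.1 ↔ y' ∈ stdLattice K 3 ∧ Valued.v (B₀ σ 3 x y') < 1 := by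
        intro y'
        rw [hw1]
        constructor
        · intro hy'
          have hy'L : y' ∈ stdLattice K 3 := (mapGL_N₁_le hκ hϖ1 hϖ0).2 hy'
          have h := (mem_mapGL_N₁_iff hκ hϖ0 hy'L).1 hy'; rw [← hx] at h
          exact ⟨hy'L, (hlt1 _).2 h⟩
        · rintro ⟨hy'L, hB⟩
          refine (mem_mapGL_N₁_iff hκ hϖ0 hy'L).2 ?_; rw [← hx]; exact (hlt1 _).1 hB
      have key : ∀ p, (∃ c : K, Valued.v c = 1 ∧ ∀ i, Valued.v (x i - c * xOf p i) < 1) → f p = w := fun p hc =>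
        eq_of_forall_mem_iff fun y' => by
          rw [(hf p).2 y', hmem y']
          exact and_congr_right fun hy' => (forall_v_B₀_lt_one_iff_of_exists_unit_congr hd.vσ hc y' hy').symm
      -- `B₀(x,x) = σa·a·B₀(u,u) + (small)` whenever `x = a·u + r`, `r ∈ 𝔪³`
      have hBdec : ∀ (a : K) (u r : Fin 3 → K), u ∈ stdLattice K 3 → (∀ i, Valued.v (r i) < 1) → x = a • u + r → Valued.v a ≤ 1 →
          ∃ T, B₀ σ 3 x x = σ a * a * B₀ σ 3 u u + T ∧ Valued.v T < 1 := by
        intro a u r hu hr hxe ha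
        refine ⟨σ a * B₀ σ 3 u r + B₀ σ 3 r x, ?_, Valuation.map_add_lt _ ?_ (hBl r x hr hxint)⟩
        · have h1 : B₀ σ 3 u x = a * B₀ σ 3 u u + B₀ σ 3 u r := by rw [hxe, map_add, map_smul, smul_eq_mul]
          calc B₀ σ 3 x x = B₀ σ 3 (a • u + r) x := by rw [← hxe]
            _ = _ := by rw [map_add, LinearMap.add_apply, B₀_smul_left, h1]; ring
        · rw [map_mul, hd.vσ]; exact hm1 _ _ ha (hBr u r hu hr)
      -- frame coordinates `y = P⁻¹x`, `A y ≡ c′ y`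
      obtain ⟨y, hy⟩ : ∃ y : Fin 3 → K, y = QM.mulVec x := ⟨_, rfl⟩
      have hPy : PM.mulVec y = x := by rw [hy, Matrix.mulVec_mulVec, hPQ, Matrix.one_mulVec]
      have hyint : ∀ i, Valued.v (y i) ≤ 1 := by rw [hy]; exact mulVec_mem_stdLattice_of_forall_v_le_one hP' hxint
      have hAy : ∀ i, Valued.v ((A.mulVec y - c' • y) i) < 1 := by
        have e : A.mulVec y - c' • y = QM.mulVec (kM.mulVec x - c' • x) := by
          rw [Matrix.mulVec_sub, Matrix.mulVec_smul, ← hy, hA, ← Matrix.mulVec_mulVec, ← Matrix.mulVec_mulVec, hPy]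
        rw [e]; exact hMv QM hP' _ hcol'
      have hdi : ∀ i, Valued.v ((A i i - c') * y i) < 1 := by
        intro i
        have e : (A i i - c') * y i = (A.mulVec y - c' • y) i - ∑ j ∈ Finset.univ.erase i, A i j * y j := by
          rw [Pi.sub_apply, Pi.smul_apply, smul_eq_mul]
          change _ = (∑ j, A i j * y j) - c' * y i - _
          rw [← Finset.add_sum_erase _ _ (Finset.mem_univ i)]
          ring
        rw [e]
        refine Valuation.map_sub_lt _ (hAy i) (Valuation.map_sum_lt _ one_ne_zero fun j hj => ?_)
        rw [map_mul]; exact mul_lt_one_of_lt_of_le (hoff i j (Finset.ne_of_mem_erase hj).symm) (hyint j)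
      -- STEP 1: `y₂ ∈ 𝔪` (else `c′ ≡ A₂₂ ≢ c₁`, so `y₀, y₁ ∈ 𝔪`, `x ≡ y₂p₂` and `|B₀(x,x)| = 1`)
      have hy2 : Valued.v (y 2) < 1 := by
        by_contra hge
        have hy2' : Valued.v (y 2) = 1 := le_antisymm (hyint 2) (not_lt.1 hge)
        have hA2c : Valued.v (A 2 2 - c') < 1 := by have h := hdi 2; rwa [map_mul, hy2', mul_one] at h
        have hc1c : Valued.v (c₁ - c') = 1 := by
          have e : c₁ - c' = -(A 2 2 - c₁) + (A 2 2 - c') := by ring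
          have hlt : Valued.v (A 2 2 - c') < Valued.v (-(A 2 2 - c₁)) := by rw [Valuation.map_neg, h22]; exact hA2c
          rw [e, Valuation.map_add_eq_of_lt_left _ hlt, Valuation.map_neg, h22]
        have hsm : ∀ i, Valued.v (A i i - c₁) < 1 → Valued.v (y i) < 1 := fun i hi => by
          have hAic : Valued.v (A i i - c') = 1 := by
            have e : A i i - c' = (c₁ - c') + (A i i - c₁) := by ring
            rw [e, Valuation.map_add_eq_of_lt_left _ (by rw [hc1c]; exact hi), hc1c]
          have h := hdi i
          rwa [map_mul, hAic, one_mul] at h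
        obtain ⟨r, hr⟩ : ∃ r : Fin 3 → K, r = y 0 • p₀ + y 1 • p₁ := ⟨_, rfl⟩
        have hrlt : ∀ i, Valued.v (r i) < 1 := by rw [hr]; exact hcomb _ _ _ _ (hsm 0 h00) (hsm 1 h11) hp₀int hp₁int
        have hxdec : x = y 2 • p₂ + r := by rw [← hPy, hPdec, hr, add_comm]
        obtain ⟨T, hT, hTv⟩ := hBdec (y 2) p₂ r hp₂int hrlt hxdec (hyint 2)
        have hhead : Valued.v (σ (y 2) * y 2 * B₀ σ 3 p₂ p₂) = 1 := by rw [map_mul, map_mul, hd.vσ, hy2', one_mul, one_mul, hp2]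
        have hv : Valued.v (B₀ σ 3 x x) = 1 := by rw [hT, Valuation.map_add_eq_of_lt_left _ (by rw [hhead]; exact hTv), hhead]
        rw [hxiso0, map_zero] at hv
        exact zero_ne_one hv
      by_cases hy0 : Valued.v (y 0) = 1
      · -- CASE `|y₀| = 1`: `x = y₀·(p₀ + b p₁) + y₂p₂`, `b = y₁/y₀`; isotropy of `x` gives the trace condition on `b̄ḡ`
        have hy0ne : y 0 ≠ 0 := fun h => by rw [h, map_zero] at hy0; exact zero_ne_one hy0
        have hb : Valued.v (y 1 / y 0) ≤ 1 := by rw [map_div₀, hy0, div_one]; exact hyint 1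
        set b : 𝒪[K] := ⟨y 1 / y 0, hb⟩ with hbdef
        obtain ⟨u, hu⟩ : ∃ u : Fin 3 → K, u = p₀ + (b : K) • p₁ := ⟨_, rfl⟩
        have huint : u ∈ stdLattice K 3 := by rw [hu]; exact hul b
        obtain ⟨r, hr⟩ : ∃ r : Fin 3 → K, r = y 2 • p₂ := ⟨_, rfl⟩
        have hrlt : ∀ i, Valued.v (r i) < 1 := fun i => by
          rw [hr, Pi.smul_apply, smul_eq_mul, map_mul]; exact mul_lt_one_of_lt_of_le hy2 (hp₂int i)
        have hxdec : x = y 0 • u + r := by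
          have e : y 1 = y 0 * (b : K) := by rw [hbdef]; field_simp
          rw [← hPy, hPdec, hu, hr, smul_add, smul_smul, ← e]
        obtain ⟨T, hT, hTv⟩ := hBdec (y 0) u r huint hrlt hxdec (hyint 0)
        have huu : Valued.v (B₀ σ 3 u u) < 1 := by
          have e : σ (y 0) * y 0 * B₀ σ 3 u u = -T := by rw [eq_neg_iff_add_eq_zero, ← hT]; exact hxiso0
          have h : Valued.v (σ (y 0) * y 0 * B₀ σ 3 u u) < 1 := by rw [e, Valuation.map_neg]; exact hTv
          rwa [map_mul, map_mul, hd.vσ, hy0, one_mul, one_mul] at h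
        have hEv : Valued.v (((b * g + ⟨σ ((b * g : 𝒪[K]) : K), hσO (b * g)⟩ : 𝒪[K]) : K)) < 1 := by
          have e : (((b * g + ⟨σ ((b * g : 𝒪[K]) : K), hσO (b * g)⟩ : 𝒪[K]) : K)) = B₀ σ 3 u u - (B₀ σ 3 p₀ p₀ + σ (b : K) * (b : K) * B₀ σ 3 p₁ p₁) := by
            rw [hu, hBu]; ring
          rw [e]; exact Valuation.map_sub_lt _ huu (hBu_tail b)
        have ht : σk (IsLocalRing.residue 𝒪[K] b * IsLocalRing.residue 𝒪[K] g) + IsLocalRing.residue 𝒪[K] b * IsLocalRing.residue 𝒪[K] g = 0 := by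
          have h := (residue_eq_zero_iff_v_lt_one _).2 hEv
          rw [hE] at h; rwa [add_comm] at h
        have hbb : Valued.v ((b : K) - (bOf ⟨_, ht⟩ : K)) < 1 := by
          have hres : IsLocalRing.residue 𝒪[K] (bOf ⟨_, ht⟩) = IsLocalRing.residue 𝒪[K] b := mul_right_cancel₀ hgbar (hbres ⟨_, ht⟩)
          rw [← coe_sub_eq, ← residue_eq_zero_iff_v_lt_one, map_sub, hres, sub_self]
        refine ⟨some ⟨_, ht⟩, Subtype.ext (key _ ⟨y 0, hy0, fun i => ?_⟩)⟩
        have e : x i - y 0 * xOf (some ⟨_, ht⟩) i = ((y 0 * ((b : K) - (bOf ⟨_, ht⟩ : K))) • p₁ + y 2 • p₂) i := by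
          rw [hxsome]
          conv_lhs => rw [hxdec, hu, hr]
          simp only [Pi.add_apply, Pi.smul_apply, smul_eq_mul]
          ring
        rw [e]
        refine hcomb _ _ _ _ ?_ hy2 hp₁int hp₂int i
        rw [map_mul, hy0, one_mul]; exact hbb
      · -- CASE `y₀ ∈ 𝔪`: then `|y₁| = 1` (primitivity) and `x ≡ y₁p₁`
        have hy0lt : Valued.v (y 0) < 1 := lt_of_le_of_ne (hyint 0) hy0
        have hy1 : Valued.v (y 1) = 1 := by
          by_contra hne
          have hlt : ∀ a, Valued.v (y a) < 1 := fun a => by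
            fin_cases a
            exacts [hy0lt, lt_of_le_of_ne (hyint 1) hne, hy2]
          have h := hMv PM hP y hlt i₀
          rw [hPy] at h; exact absurd hxi₀ h.ne
        refine ⟨none, Subtype.ext (key _ ⟨y 1, hy1, fun i => ?_⟩)⟩
        have e : x i - y 1 * xOf none i = (y 0 • p₀ + y 2 • p₂) i := by
          rw [hxnone]
          conv_lhs => rw [← hPy, hPdec]
          simp only [Pi.add_apply, Pi.smul_apply, smul_eq_mul]
          ring
        rw [e]
        exact hcomb _ _ _ _ hy0lt hy2 hp₀int hp₂int i
  rw [← Nat.card_coe_set_eq, ← Nat.card_eq_of_bijective _ hbij, Finite.card_option, natCard_traceKer hq σk hfrob]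

end Summit.HodgeConjecture.HodgeConjecture.R90.S6

end
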